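import Summits.AnomalousDissipation.AnomalousDissipation.Theorems.SolenoidalFractalHomogenisationLagrangianStepSidebandMaskDefs
import Summits.AnomalousDissipation.AnomalousDissipation.Theorems.SolenoidalFractalHomogenisationLagrangianStepSidebandSlot
import Summits.AnomalousDissipation.AnomalousDissipation.Theorems.SolenoidalFractalHomogenisationLagrangianStepSidebandDecay
import Summits.AnomalousDissipation.AnomalousDissipation.Theorems.SolenoidalFractalHomogenisationLagrangianStepSidebandResponseExtContinuous
import Mathlib.Analysis.Calculus.MeanValue
import Mathlib.Analysis.InnerProductSpace.Calculus
import HarnessLib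

/-!
# K1L_D `stub_D1_residueTail` (registry v17, stmt-AnomalousDissipation-27980) — lane A4 brick E-1: MASKED ENERGY DECAY of the periodic sideband
# response (helper; `--supports stmt-AnomalousDissipation-27980`)

Summits-side helper file of route `SolenoidalFractalHomogenisation` (prover seat `ad-sawtooth-k1loc-p1` g13; lane A of the tail certificate
`Lines/onelevel-D1-tail-cert.md`, cases A/B/E).  Everything proved; no definitions, no named facts, no sorry.
* `norm_maskL_le`, `maskL_maskL_of_subset`, `real_inner_maskL_right`, `maskL_univ` — the coordinate mask `maskL R A` (`…SidebandMaskDefs`) is an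
  orthogonal coordinate projection;
* **`maskL_gen_maskL`** — CLOSEDNESS: if at time `t` no active link feeds a kept fibre `z ∈ A` from a retained fibre outside `A`, then
  `maskL A (gen t (maskL A y)) = maskL A (gen t y)` — the masked part of any state evolves autonomously;
* **`norm_le_exp_of_inner_derivWithin_le`** — the energy argument with RIGHT derivatives: `u` continuous on `[a,b]`, right-differentiable on `[a,b)`
  with `⟪u', u⟫ ≤ −r‖u‖²` ⇒ `‖u b‖ ≤ e^{−r(b−a)}‖u a‖` (`image_le_of_deriv_right_le_deriv_boundary`);
* **`norm_maskL_responseExt_le_exp`** — for the `P`-periodic extension `N̄` of the response of slot `j` (`…SidebandResponseExt`: continuous, right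
  derivative `Sⱼ(t) + G(t)∘N̄(t)` EVERYWHERE), on any interval `[a,b] ⊂ ℝ` along which `A` is closed and the mask kills the source:
  `‖maskL A (N̄ b v)‖ ≤ e^{−min(γ₁,4π²lo')(b−a)} ‖maskL A (N̄ a v)‖`; **`norm_responseExt_le_exp_of_envelope_zero`** — the unmasked case (envelope of
  slot `j` off along `[a,b)`), across period junctions (cases A/B of the memo need the decay through `t = 0 ≡ P`).
NOT a proof of any registered stub, of the crux, or of anomalous dissipation; rung leaf F-D1 infrastructure.
-/

set_option linter.dupNamespace false

noncomputable section

namespace Summit.AnomalousDissipation.AnomalousDissipation.Theorems.SolenoidalFractalHomogenisation.LagrangianStep.Sideband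

open Set MeasureTheory Complex
open scoped InnerProductSpace
open Literature.Analysis Literature.Analysis.FunctionSpaces Literature.Analysis.FunctionSpaces.Torus
open Literature.Analysis.FluidPDE Literature.Analysis.FluidPDE.Torus Literature.Analysis.FluidPDE.LatticeShear
open Summit.AnomalousDissipation.AnomalousDissipation.Theorems.SolenoidalFractalHomogenisation.LagrangianStep.CellChain (linkCoeff)

variable {k₀ : ℕ}

/-! ## §1 The mask is an orthogonal coordinate projection -/

/-- The mask does not increase the norm. [cite: MajdaKramer1999, §2.2.1.3] -/
theorem norm_maskL_le {R : ℕ} (A : Set (Fin 3 → ℤ)) (y : Space R) : ‖maskL R A y‖ ≤ ‖y‖ := by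
  classical
  have h2 : ‖maskL R A y‖ ^ 2 ≤ ‖y‖ ^ 2 := by
    rw [PiLp.norm_sq_eq_of_L2, PiLp.norm_sq_eq_of_L2]
    refine Finset.sum_le_sum fun z _ => ?_
    by_cases hz : (z : Fin 3 → ℤ) ∈ A
    · rw [maskL_apply_of_mem hz]
    · rw [maskL_apply_of_not_mem hz, norm_zero, zero_pow two_ne_zero]; positivity
  exact (pow_le_pow_iff_left₀ (norm_nonneg _) (norm_nonneg _) two_ne_zero).1 h2

/-- Masking onto `A ⊆ B` after masking onto `B` is masking onto `A`. [cite: MajdaKramer1999, §2.2.1.3] -/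
theorem maskL_maskL_of_subset {R : ℕ} {A B : Set (Fin 3 → ℤ)} (hAB : A ⊆ B) (y : Space R) :
    maskL R A (maskL R B y) = maskL R A y := by
  ext z : 1
  by_cases hz : (z : Fin 3 → ℤ) ∈ A
  · rw [maskL_apply_of_mem hz, maskL_apply_of_mem hz, maskL_apply_of_mem (hAB hz)]
  · rw [maskL_apply_of_not_mem hz, maskL_apply_of_not_mem hz]

/-- The mask onto everything is the identity. [cite: MajdaKramer1999, §2.2.1.3] -/
theorem maskL_univ {R : ℕ} (y : Space R) : maskL R Set.univ y = y := by
  ext z : 1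
  rw [maskL_apply_of_mem (Set.mem_univ _)]

/-- The mask is self-adjoint and idempotent in the real pairing: `⟪x, maskL A y⟫_ℝ = ⟪maskL A x, maskL A y⟫_ℝ`. [cite: MajdaKramer1999, §2.2.1.3] -/
theorem real_inner_maskL_right {R : ℕ} (A : Set (Fin 3 → ℤ)) (x y : Space R) :
    ⟪x, maskL R A y⟫_ℝ = ⟪maskL R A x, maskL R A y⟫_ℝ := by
  rw [real_inner_space_eq_sum, real_inner_space_eq_sum]
  refine Finset.sum_congr rfl fun z _ => ?_
  by_cases hz : (z : Fin 3 → ℤ) ∈ A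
  · rw [maskL_apply_of_mem hz, maskL_apply_of_mem hz]
  · rw [maskL_apply_of_not_mem hz, inner_zero_right, inner_zero_right]

/-! ## §2 Closedness: the masked part evolves autonomously when no active link feeds `A` from outside -/

/-- **CLOSEDNESS OF THE MASK UNDER THE GENERATOR.**  If at time `t`, for every kept fibre `z ∈ A` and every slot `i`, the link coefficient
`linkCoeffᵢ(z,t)` vanishes unless both neighbours `z ∓ mᵢ` are kept or not retained, then `maskL A (gen t (maskL A y)) = maskL A (gen t y)` for
every state `y`. [cite: MajdaKramer1999, §2.2.1.3 (cell problem (49))] [cite: MeshalkinSinai1961, pp. 1700–1705] -/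
theorem maskL_gen_maskL (W₁ : LatticeWord k₀) (𝔸 : Torus.Visc4 (Fin 3)) (γ₁ : ℝ) {R : ℕ} {t : ℝ} {A : Set (Fin 3 → ℤ)}
    (hlink : ∀ (i : Fin k₀) (z : box R), (z : Fin 3 → ℤ) ∈ A → ∀ w : Fin 3 → ℤ,
      (w = z.1 - (W₁.phase i).m ∨ w = z.1 + (W₁.phase i).m) → w ∈ box R → w ∉ A → linkCoeff W₁ 1 z.1 i t = 0)
    (y : Space R) :
    maskL R A (gen W₁ 𝔸 γ₁ R t (maskL R A y)) = maskL R A (gen W₁ 𝔸 γ₁ R t y) := by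
  ext z : 1
  by_cases hz : (z : Fin 3 → ℤ) ∈ A
  · -- the link sum reads the same through the mask: each active link has both neighbours kept or not retained
    have hsum : ∑ i, linkCoeff W₁ 1 z.1 i t • transversalProj z.1
        (slotAmp W₁ i • transversalProj (z.1 - (W₁.phase i).m) (coordL R (z.1 - (W₁.phase i).m) (maskL R A y)) +
          starRingEnd ℂ (slotAmp W₁ i) • transversalProj (z.1 + (W₁.phase i).m) (coordL R (z.1 + (W₁.phase i).m) (maskL R A y))) =
        ∑ i, linkCoeff W₁ 1 z.1 i t • transversalProj z.1
        (slotAmp W₁ i • transversalProj (z.1 - (W₁.phase i).m) (coordL R (z.1 - (W₁.phase i).m) y) +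
          starRingEnd ℂ (slotAmp W₁ i) • transversalProj (z.1 + (W₁.phase i).m) (coordL R (z.1 + (W₁.phase i).m) y)) := by
      refine Finset.sum_congr rfl fun i _ => ?_
      by_cases hl : linkCoeff W₁ 1 z.1 i t = 0
      · rw [hl, zero_smul, zero_smul]
      · have hread : ∀ w : Fin 3 → ℤ, (w = z.1 - (W₁.phase i).m ∨ w = z.1 + (W₁.phase i).m) →
            coordL R w (maskL R A y) = coordL R w y := by
          intro w hw
          by_cases hwA : w ∈ A
          · exact coordL_maskL_of_mem hwA y
          · by_cases hwb : w ∈ box R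
            · exact absurd (hlink i z hz w hw hwb hwA) hl
            · rw [coordL_apply_of_not_mem hwb, coordL_apply_of_not_mem hwb]
        rw [hread _ (Or.inl rfl), hread _ (Or.inr rfl)]
    rw [maskL_apply_of_mem hz, maskL_apply_of_mem hz, gen_apply, gen_apply, genComp_apply, genComp_apply, coordL_maskL_of_mem hz, hsum]
  · rw [maskL_apply_of_not_mem hz, maskL_apply_of_not_mem hz]

/-! ## §3 Energy decay with right derivatives -/

/-- **ENERGY DECAY WITH RIGHT DERIVATIVES.**  In a real inner-product space: if `u` is continuous on `[a,b]`, has the right derivative `u' t` at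
every `t ∈ [a,b)`, and `⟪u' t, u t⟫ ≤ −r‖u t‖²` there, then `‖u b‖ ≤ e^{−r(b−a)}‖u a‖`. [cite: SandersVerhulstMurdock2007, Lemma 5.2.7 (linear case)] -/
theorem norm_le_exp_of_inner_derivWithin_le {E : Type*} [NormedAddCommGroup E] [InnerProductSpace ℝ E]
    {u u' : ℝ → E} {a b r : ℝ} (hab : a ≤ b) (hc : ContinuousOn u (Icc a b))
    (hd : ∀ t ∈ Ico a b, HasDerivWithinAt u (u' t) (Ici t) t)
    (hdis : ∀ t ∈ Ico a b, ⟪u' t, u t⟫_ℝ ≤ -r * ‖u t‖ ^ 2) :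
    ‖u b‖ ≤ Real.exp (-(r * (b - a))) * ‖u a‖ := by
  set ψ : ℝ → ℝ := fun t => Real.exp (2 * r * t) * ‖u t‖ ^ 2 with hψ
  have hψc : ContinuousOn ψ (Icc a b) :=
    (Real.continuous_exp.comp (continuous_const.mul continuous_id)).continuousOn.mul ((continuous_norm.comp_continuousOn hc).pow 2)
  have hψd : ∀ t ∈ Ico a b, HasDerivWithinAt ψ
      (Real.exp (2 * r * t) * (2 * r) * ‖u t‖ ^ 2 + Real.exp (2 * r * t) * (2 * ⟪u t, u' t⟫_ℝ)) (Ici t) t := by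
    intro t ht
    have h1 : HasDerivWithinAt (fun s => Real.exp (2 * r * s)) (Real.exp (2 * r * t) * (2 * r)) (Ici t) t := by
      have h := ((hasDerivAt_id t).const_mul (2 * r)).exp.hasDerivWithinAt (s := Ici t)
      simpa using h
    have h2 : HasDerivWithinAt (fun s => ‖u s‖ ^ 2) (2 * ⟪u t, u' t⟫_ℝ) (Ici t) t := by
      have h := (hd t ht).norm_sq
      simpa using h
    exact h1.mul h2
  have hbound : ∀ t ∈ Ico a b,
      Real.exp (2 * r * t) * (2 * r) * ‖u t‖ ^ 2 + Real.exp (2 * r * t) * (2 * ⟪u t, u' t⟫_ℝ) ≤ (fun _ => (0:ℝ)) t := by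
    intro t ht
    have hg := hdis t ht
    rw [real_inner_comm] at hg
    have he : 0 < Real.exp (2 * r * t) := Real.exp_pos _
    show _ ≤ (0:ℝ)
    nlinarith
  have hmono := image_le_of_deriv_right_le_deriv_boundary hψc hψd (B := fun _ => ψ a) (B' := fun _ => 0) le_rfl continuousOn_const
    (fun t _ => hasDerivWithinAt_const t (Ici t) (ψ a)) hbound (right_mem_Icc.2 hab)
  simp only [hψ] at hmono
  have hsq : ‖u b‖ ^ 2 ≤ (Real.exp (-(r * (b - a))) * ‖u a‖) ^ 2 := by
    rw [mul_pow, ← Real.exp_nat_mul]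
    have hexp : Real.exp (↑(2:ℕ) * -(r * (b - a))) * Real.exp (2 * r * b) = Real.exp (2 * r * a) := by
      rw [← Real.exp_add]; congr 1; push_cast; ring
    have := mul_le_mul_of_nonneg_left hmono (Real.exp_pos (↑(2:ℕ) * -(r * (b - a)))).le
    rw [← mul_assoc, ← mul_assoc, hexp] at this
    have he1 : 0 < Real.exp (2 * r * a) := Real.exp_pos _
    nlinarith [this]
  have hnn : 0 ≤ Real.exp (-(r * (b - a))) * ‖u a‖ := by positivity
  exact (abs_le_of_sq_le_sq' hsq hnn).2

/-! ## §4 Masked and plain decay of the periodic extension of a response -/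

/-- **MASKED DECAY OF THE PERIODIC RESPONSE.**  Let `N̄ = responseExt W₁ 𝔸 γ₁ R j` (`NearIso 𝔸 lo' hi'`, `lo' ≥ 0`, the response of slot `j` being a
periodic response).  If along `[a,b)` the set `A` is closed under the active links (hypothesis of `maskL_gen_maskL` at every `t`) and the mask kills the
source of slot `j`, then `‖maskL A (N̄ b v)‖ ≤ e^{−min(γ₁,4π²lo')(b−a)}·‖maskL A (N̄ a v)‖`. [cite: SandersVerhulstMurdock2007, Lemma 5.2.7 (linear case)]
[cite: MajdaKramer1999, §2.2.1.3 (cell problem (49))] -/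
theorem norm_maskL_responseExt_le_exp (W₁ : LatticeWord k₀) {𝔸 : Torus.Visc4 (Fin 3)} {lo' hi' : ℝ} (h𝔸 : Torus.NearIso 𝔸 lo' hi')
    (hlo' : 0 ≤ lo') (γ₁ : ℝ) (R : ℕ) (j : Fin k₀) (hN : IsPeriodicResponse W₁ 𝔸 γ₁ R j (response W₁ 𝔸 γ₁ R j))
    (A : Set (Fin 3 → ℤ)) (v : EuclideanSpace ℂ (Fin 3)) {a b : ℝ} (hab : a ≤ b)
    (hlink : ∀ t ∈ Ico a b, ∀ (i : Fin k₀) (z : box R), (z : Fin 3 → ℤ) ∈ A → ∀ w : Fin 3 → ℤ,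
      (w = z.1 - (W₁.phase i).m ∨ w = z.1 + (W₁.phase i).m) → w ∈ box R → w ∉ A → linkCoeff W₁ 1 z.1 i t = 0)
    (hsrc : ∀ t ∈ Ico a b, maskL R A (source W₁ R j t v) = 0) :
    ‖maskL R A (responseExt W₁ 𝔸 γ₁ R j b v)‖ ≤
      Real.exp (-(min γ₁ (4 * Real.pi ^ 2 * lo') * (b - a))) * ‖maskL R A (responseExt W₁ 𝔸 γ₁ R j a v)‖ := by
  set N := responseExt W₁ 𝔸 γ₁ R j with hNdef
  set u : ℝ → Space R := fun t => maskL R A (N t v) with hu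
  set u' : ℝ → Space R := fun t => maskL R A (gen W₁ 𝔸 γ₁ R t (N t v)) with hu'
  have hc : ContinuousOn u (Icc a b) :=
    ((maskL R A).continuous.comp ((continuous_responseExt W₁ 𝔸 γ₁ R j hN).clm_apply continuous_const)).continuousOn
  have hd : ∀ t ∈ Ico a b, HasDerivWithinAt u (u' t) (Ici t) t := by
    intro t ht
    have h1 := (hasDerivWithinAt_responseExt W₁ 𝔸 γ₁ R j hN t).clm_apply (hasDerivWithinAt_const t (Ici t) v)
    have h2 := ((maskL R A).restrictScalars ℝ).hasFDerivAt.comp_hasDerivWithinAt t h1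
    refine h2.congr_deriv ?_
    simp only [hu', hNdef, ContinuousLinearMap.coe_restrictScalars', add_apply, ContinuousLinearMap.comp_apply, map_zero, add_zero,
      map_add, hsrc t ht, zero_add]
  have hdis : ∀ t ∈ Ico a b, ⟪u' t, u t⟫_ℝ ≤ -(min γ₁ (4 * Real.pi ^ 2 * lo')) * ‖u t‖ ^ 2 := by
    intro t ht
    have hcl := maskL_gen_maskL W₁ 𝔸 γ₁ (hlink t ht) (N t v)
    have hg := real_inner_gen_le W₁ h𝔸 hlo' γ₁ R t (maskL R A (N t v))
    simp only [hu, hu']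
    rw [← hcl, ← real_inner_maskL_right]
    exact hg
  exact norm_le_exp_of_inner_derivWithin_le hab hc hd hdis

/-- **PLAIN DECAY OF THE PERIODIC RESPONSE ACROSS PERIOD JUNCTIONS.**  If the envelope of slot `j` vanishes along `[a,b)`, then
`‖N̄ b v‖ ≤ e^{−min(γ₁,4π²lo')(b−a)}‖N̄ a v‖` for the periodic extension `N̄` of the response of slot `j`. [cite: SandersVerhulstMurdock2007, Lemma 5.2.7 (linear case)] -/
theorem norm_responseExt_le_exp_of_envelope_zero (W₁ : LatticeWord k₀) {𝔸 : Torus.Visc4 (Fin 3)} {lo' hi' : ℝ} (h𝔸 : Torus.NearIso 𝔸 lo' hi')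
    (hlo' : 0 ≤ lo') (γ₁ : ℝ) (R : ℕ) (j : Fin k₀) (hN : IsPeriodicResponse W₁ 𝔸 γ₁ R j (response W₁ 𝔸 γ₁ R j))
    (v : EuclideanSpace ℂ (Fin 3)) {a b : ℝ} (hab : a ≤ b) (henv : ∀ t ∈ Ico a b, slotEnvelope W₁ j t = 0) :
    ‖responseExt W₁ 𝔸 γ₁ R j b v‖ ≤ Real.exp (-(min γ₁ (4 * Real.pi ^ 2 * lo') * (b - a))) * ‖responseExt W₁ 𝔸 γ₁ R j a v‖ := by
  have h := norm_maskL_responseExt_le_exp W₁ h𝔸 hlo' γ₁ R j hN Set.univ v hab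
    (fun t _ i z _ w _ _ hw => absurd (Set.mem_univ w) hw)
    (fun t ht => by rw [source_eq_zero_of_slotEnvelope W₁ R j (henv t ht)]; simp)
  rwa [maskL_univ, maskL_univ] at h

end Summit.AnomalousDissipation.AnomalousDissipation.Theorems.SolenoidalFractalHomogenisation.LagrangianStep.Sideband

end
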